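import Literature.AnabelianGeometry.SemiGraphs.TemperedPiAction

/-!
# Compatibility of the actions of `Gal(𝒢_{∞,n+1}/𝒢)` and `Gal(𝒢_{∞,n}/𝒢)` ([SemiAnbd] Prop. 3.6, p. 38)

Sequel to `TemperedPiAction.lean`: the action of `G_{n+1} = Aut(𝒢_{∞,n+1})` on the points of a
covering split by `S n` (hence by `S (n+1)`) factors through the transition map
`step : G_{n+1} → G_n`: `actAt (n+1) σ t = actAt n (step σ) t` (`actAt_succ`).  This is the
compatibility making `π₁^temp(𝒢) = lim_n G_n` act on the fibres of every tempered covering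
([SemiAnbd] p. 38: "compatible maps `𝒢_{∞,j} → 𝒢_{∞,i}`, hence … `Gal(𝒢_{∞,j}/𝒢) → Gal(𝒢_{∞,i}/𝒢)`").
-/

namespace Literature.AnabelianGeometry.SemiGraphs

namespace ProfiniteSemiGraph

open CategoryTheory

universe u

variable {𝒢 : ProfiniteSemiGraph.{u}}

namespace GaloisLevelData

variable (D : GaloisLevelData 𝒢) (h𝒢 : 𝒢.IsCountable) (T : CovObj 𝒢) (t : (T.SV D.v₀).obj.V) (n : ℕ)

/-- The splitting by `S (n+1)` follows from the splitting by `S n`. [cite: MochizukiSemiAnbd2006, Prop 3.6 p.38] -/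
theorem splits_succ (hs : (D.S n).Splits (T.component (Sum.inl ⟨D.v₀, t⟩))) :
    (D.S (n + 1)).Splits (T.component (Sum.inl ⟨D.v₀, t⟩)) :=
  CovObj.Splits.of_hom (D.g n) hs

/-- General base-point form of the identification `𝒢_{∞,S n}` based at `ḡ W_{n+1}` versus at
`W n`: for ANY point `x'` with `g (x (n+1)) = x'`, the eqToHom-composite of the projection with the
universal morphism based at `x'` is the universal morphism based at `x (n+1)`.
[cite: MochizukiSemiAnbd2006, Prop 3.6 p.38] -/
theorem projOver_comp_liftHom (x' : ((D.S n).SV D.v₀).obj.V)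
    (e : ((D.g n).fV D.v₀).hom.hom (D.x (n + 1)) = x')
    (hs' : (D.S n).Splits (T.component (Sum.inl ⟨D.v₀, t⟩))) :
    CovObj.projOver (D.g n) (D.W (n + 1)) h𝒢 ≫
      eqToHom (congrArg (fun y => (D.S n).univCoverOver (Sum.inl (Quot.mk _ ⟨D.v₀, y⟩)) h𝒢) e) ≫
      CovObj.liftHom (D.S n) (T.component (Sum.inl ⟨D.v₀, t⟩)) hs' x'
        (⟨t, CovObj.mem_component_self T t⟩ : T.CompV (Sum.inl ⟨D.v₀, t⟩) D.v₀) h𝒢 =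
      D.liftAt h𝒢 T t (n + 1) (D.splits_succ T t n hs') := by
  subst e
  apply D.hom_ext_bp h𝒢 (n + 1)
  rw [D.liftAt_bp]
  -- the image of `bp_{n+1}` under the projection is the base point at `g (x (n+1))`
  have hpt : ((CovObj.projOver (D.g n) (D.W (n + 1)) h𝒢).fV D.v₀).hom.hom (D.bp (n + 1)) =
      (⟨⟨Quot.mk _ ⟨D.v₀, ((D.g n).fV D.v₀).hom.hom (D.x (n + 1))⟩, rfl⟩,
        ⟨⟨((D.g n).fV D.v₀).hom.hom (D.x (n + 1)), rfl⟩, 𝟙 _⟩⟩ :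
        (D.S n).FibV (Sum.inl (Quot.mk _ ⟨D.v₀, ((D.g n).fV D.v₀).hom.hom (D.x (n + 1))⟩)) D.v₀) := by
    refine CovObj.FibV.ext (D.S n) _ rfl rfl (heq_of_eq ?_)
    exact (SemiGraph.Hom.mapFundamentalGroupoid (CovObj.orbitGraphMap (D.g n))).map_id _
  change ((CovObj.liftHom (D.S n) _ hs' _ _ h𝒢).fV D.v₀).hom.hom
    (((CovObj.projOver (D.g n) (D.W (n + 1)) h𝒢).fV D.v₀).hom.hom (D.bp (n + 1))) = _
  rw [hpt]
  exact CovObj.liftHom_basePt (D.S n) _ hs' _ _ h𝒢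

/-- The projection maps the base point of `𝒢_{∞,n+1}` to (the cast of) the base point of `𝒢_{∞,n}`.
[cite: MochizukiSemiAnbd2006, Prop 3.6 p.38] -/
theorem baseIso_projOver_bp (x' : ((D.S n).SV D.v₀).obj.V)
    (e : ((D.g n).fV D.v₀).hom.hom (D.x (n + 1)) = x') :
    ((CovObj.projOver (D.g n) (D.W (n + 1)) h𝒢 ≫
      eqToHom (congrArg (fun y => (D.S n).univCoverOver (Sum.inl (Quot.mk _ ⟨D.v₀, y⟩)) h𝒢) e)).fV
        D.v₀).hom.hom (D.bp (n + 1)) =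
      (⟨⟨Quot.mk _ ⟨D.v₀, x'⟩, rfl⟩, ⟨⟨x', rfl⟩, 𝟙 _⟩⟩ :
        (D.S n).FibV (Sum.inl (Quot.mk _ ⟨D.v₀, x'⟩)) D.v₀) := by
  subst e
  refine CovObj.FibV.ext (D.S n) _ rfl rfl (heq_of_eq ?_)
  exact (SemiGraph.Hom.mapFundamentalGroupoid (CovObj.orbitGraphMap (D.g n))).map_id _

/-- **Level change**: the action of `σ ∈ G_{n+1}` on `t` equals the action of `step σ ∈ G_n`.
[cite: MochizukiSemiAnbd2006, Prop 3.6 p.38] -/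
theorem actAt_succ (hs : (D.S n).Splits (T.component (Sum.inl ⟨D.v₀, t⟩))) (σ : D.Gal h𝒢 (n + 1)) :
    D.actAt h𝒢 T t (n + 1) (D.splits_succ T t n hs) σ = D.actAt h𝒢 T t n hs (D.step h𝒢 n σ) := by
  -- the universal morphism at level `n+1` factors through the projection
  have hfac := D.projOver_comp_liftHom h𝒢 T t n (D.x n) (D.hx n) hs
  -- descent: `σ⁻¹ ≫ π = π ≫ descend σ⁻¹`, evaluated at `bp_{n+1}`
  have hd : ((CovObj.projOver (D.g n) (D.W (n + 1)) h𝒢).fV D.v₀).hom.hom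
      (((σ⁻¹ : D.Gal h𝒢 (n + 1)).hom.fV D.v₀).hom.hom (D.bp (n + 1))) =
      ((CovObj.descend (D.g n) (D.W (n + 1)) h𝒢 (D.htrans n) σ⁻¹).hom.fV D.v₀).hom.hom
        (((CovObj.projOver (D.g n) (D.W (n + 1)) h𝒢).fV D.v₀).hom.hom (D.bp (n + 1))) :=
    congrArg (fun φ : D.cover h𝒢 (n + 1) ⟶ _ => (φ.fV D.v₀).hom.hom (D.bp (n + 1)))
      (CovObj.hom_comp_projOver (D.g n) (D.W (n + 1)) h𝒢 (D.htrans n) σ⁻¹)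
  -- `step σ⁻¹ = baseIso⁻¹ ≫ descend σ⁻¹ ≫ baseIso`
  have hstep : D.step h𝒢 n σ⁻¹ = (D.step h𝒢 n σ)⁻¹ := map_inv _ _
  have hstepdef : (D.step h𝒢 n σ⁻¹).hom = (D.baseIso h𝒢 n).inv ≫
      (CovObj.descend (D.g n) (D.W (n + 1)) h𝒢 (D.htrans n) σ⁻¹).hom ≫ (D.baseIso h𝒢 n).hom := by
    change ((D.baseIso h𝒢 n).conjAut (CovObj.descend (D.g n) (D.W (n + 1)) h𝒢 (D.htrans n) σ⁻¹)).hom = _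
    rw [Iso.conjAut_hom, Iso.conj_apply]
  -- `baseIso⁻¹ bp_n = π bp_{n+1}`
  have h2 := D.baseIso_projOver_bp h𝒢 n (D.x n) (D.hx n)
  have h3 : (((D.baseIso h𝒢 n).inv).fV D.v₀).hom.hom (D.bp n) =
      ((CovObj.projOver (D.g n) (D.W (n + 1)) h𝒢).fV D.v₀).hom.hom (D.bp (n + 1)) := by
    have h2' := congrArg (fun z => (((D.baseIso h𝒢 n).inv).fV D.v₀).hom.hom z) h2
    change (((CovObj.projOver (D.g n) (D.W (n + 1)) h𝒢 ≫ (D.baseIso h𝒢 n).hom) ≫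
      (D.baseIso h𝒢 n).inv).fV D.v₀).hom.hom (D.bp (n + 1)) = _ at h2'
    rw [Category.assoc, Iso.hom_inv_id, Category.comp_id] at h2'
    exact h2'.symm
  -- assemble
  change (((D.liftAt h𝒢 T t (n + 1) (D.splits_succ T t n hs)).fV D.v₀).hom.hom
    (((σ⁻¹ : D.Gal h𝒢 (n + 1)).hom.fV D.v₀).hom.hom (D.bp (n + 1)))).1 =
    (((D.liftAt h𝒢 T t n hs).fV D.v₀).hom.hom
      ((((D.step h𝒢 n σ)⁻¹ : D.Gal h𝒢 n).hom.fV D.v₀).hom.hom (D.bp n))).1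
  rw [← hfac, ← hstep, hstepdef]
  change (((D.liftAt h𝒢 T t n hs).fV D.v₀).hom.hom ((((D.baseIso h𝒢 n).hom).fV D.v₀).hom.hom
      (((CovObj.projOver (D.g n) (D.W (n + 1)) h𝒢).fV D.v₀).hom.hom
        (((σ⁻¹ : D.Gal h𝒢 (n + 1)).hom.fV D.v₀).hom.hom (D.bp (n + 1)))))).1 =
    (((D.liftAt h𝒢 T t n hs).fV D.v₀).hom.hom ((((D.baseIso h𝒢 n).hom).fV D.v₀).hom.hom
      (((CovObj.descend (D.g n) (D.W (n + 1)) h𝒢 (D.htrans n) σ⁻¹).hom.fV D.v₀).hom.hom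
        ((((D.baseIso h𝒢 n).inv).fV D.v₀).hom.hom (D.bp n))))).1
  rw [h3, hd]

end GaloisLevelData

end ProfiniteSemiGraph

end Literature.AnabelianGeometry.SemiGraphs
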